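import Summits.QuantumAdvantage.AdviceFreeQNC0.BlockSplitCore
import Summits.QuantumAdvantage.AdviceFreeQNC0.TensorMultZero
import Literature.Computability.MetaComplexity.SmolenskyCorrelationRestrict
import Mathlib.Analysis.SpecialFunctions.Log.Base
import HarnessLib

/-!
# Cell qa-qnc0 (rung F-Q1, crux α `RingToElim` / density target T10, many-blocks corner): the
# FIXED-BLOCK-SIZE family of Sketch13 v2 — `BlockSplitFixed`, `TensorMultAt`, `TensorMultAtPays`

Planner qa-qnc0-p1 gen 13 (`HOME/qa-qnc0-p1/ROUND-12.md` §2.7(c), `Sketch13.lean` v2, ask P18 amended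
09:04Z): only TERM-CARRYING blocks cost a factor, so the reduction may use `k` leading intervals of
ONE size `m` (the first `m·k` coordinates) and a term-free remainder of `r` coordinates whose fibres
are free; the crux of record becomes `TensorMultOneAt` (SOME block size pays at block degree `1`).
Statements VERBATIM from Sketch13 v2 (`BlockSplitFixed`, `TensorMultAt`, `TensorMultOneAt`,
`TensorMultAtPays`, `MultOneAtPays`), and PROVED:

* **`blockSplitFixed : ∀ t, BlockSplitFixed t`** — for every remainder content `z`, the restricted
  win indicator `u ↦ WIN(u ++ z)` lies in the `k`-block sum code at block degree `t` on `{0,1}^{mk}`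
  (`D < (t+1)(k−1)`).  One line from the general engine `BlockSplitCore.sumCodeWinB_ringWinU`
  (monotone block map `i ↦ ⌊i/m⌋` on the first `mk` coordinates, `k` on the remainder) plus the
  restriction along `Fin.append · z` (`Smolensky.comp_append_mem_lowDeg`).
* **`tensorMultAt_zero`**: `0 ≤ β < 1/3 ⇒ ∃ m₀, ∀ m ≥ m₀, TensorMultAt m 0 β` — the degree-`0` rung at a
  fixed block size (engine `SumCodeZero.pow_mul_le_card_fails`, blocks `⌊ik/(mk)⌋ = ⌊i/m⌋` of size `m`).
* **`tensorMultAtPays : TensorMultAtPays`**, `multOneAtPays : MultOneAtPays` — the §2.2 arithmetic in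
  the fixed-size form: `n = m·k + r` with `k = ⌊D/(t+1)⌋ + 2`, fail `≥ Σ_z (β2^m)^k = β^k·2ⁿ ≥ 2^{n−cD}`,
  `c = (1 + c₀)/2`, `c₀ = log₂(1/min(β,1))/(t+1) < 1` (as in `tensorMultPays`, `TensorBlocks.lean`).

WHAT THIS IS NOT: `TensorMultAt m 1 β` for some `β > 1/4` (`TensorMultOneAt`, the crux MULT₁ of record)
is OPEN; `T10W`, crux α untouched; separation NOT moved.
-/

noncomputable section

namespace Summit.QuantumAdvantage.AdviceFreeQNC0

open Finset
open Literature.Computability.MetaComplexity Literature.Computability.MetaComplexity.Smolensky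

/-! ### Sketch13 v2 statements (verbatim) -/

/-- Block splitting with `k` leading intervals of size `m` and a free remainder of size `r`:
for every assignment `z` of the remainder, the restricted walk win-indicator lies in the `k`-block
sum code at block degree `t`.  (Planner qa-qnc0-p1 Sketch13 v2, verbatim; proved below.) -/
def BlockSplitFixed (t : ℕ) : Prop :=
  ∀ (m k r D c : ℕ) (y : Fin (m * k + r + 1) → (Fin (m * k + r) → Bool) → Bool),
    0 < k → D < (t + 1) * (k - 1) → (∀ g, HasDeg (y g) D) →
      ∀ z : Fin r → Bool, SumCodeWin (m * k) k t (fun u => ringWinU c y (Fin.append u z))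

/-- Tensor multiplicativity AT ONE BLOCK SIZE `m`: every element of `𝟙 + S_k(m,t)` has weight
`≥ (β·2^m)^k`, uniformly in `k`.  (Sketch13 v2, verbatim; CONJECTURE at `t ≥ 1` for `β > 2^{-(t+1)}`.) -/
def TensorMultAt (m t : ℕ) (β : ℝ) : Prop :=
  ∀ k : ℕ, 0 < k → ∀ win : (Fin (m * k) → Bool) → Bool,
    SumCodeWin (m * k) k t win → (β * (2 : ℝ) ^ m) ^ k ≤ (failCount win : ℝ)

/-- The crux of record at `t = 1`: SOME block size pays.  (Sketch13 v2, verbatim; OPEN.) -/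
def TensorMultOneAt : Prop := ∃ (m : ℕ) (β : ℝ), 1 / 4 < β ∧ TensorMultAt m 1 β

/-- Arithmetic of ROUND-12 §2.2 in the fixed-size form.  (Sketch13 v2, verbatim; proved below.) -/
def TensorMultAtPays : Prop :=
  ∀ (m t : ℕ) (β : ℝ), (2 : ℝ) ^ (-((t : ℝ) + 1)) < β → BlockSplitFixed t → TensorMultAt m t β → T10W

/-- Corollary shape at `t = 1`.  (Sketch13 v2, verbatim; proved below.) -/
def MultOneAtPays : Prop := BlockSplitFixed 1 → TensorMultOneAt → T10W

/-! ### The fixed-size block map and the restriction along `Fin.append · z` -/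

namespace TensorBlocksFixed

/-- Block map of the fixed-size split: `⌊i/m⌋` on the first `m·k` coordinates, `k` on the remainder. -/
def blkF (m k r : ℕ) (x : Fin (m * k + r)) : ℕ := if x.val < m * k then x.val / m else k

variable {m k r : ℕ}

/-- `blkF` is monotone. -/
theorem blkF_mono (x x' : Fin (m * k + r)) (h : x ≤ x') : blkF m k r x ≤ blkF m k r x' := by
  unfold blkF
  have hle : x.val ≤ x'.val := h
  by_cases hx' : x'.val < m * k
  · rw [if_pos (lt_of_le_of_lt hle hx'), if_pos hx']
    exact Nat.div_le_div_right hle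
  · rw [if_neg hx']
    by_cases hx : x.val < m * k
    · rw [if_pos hx]
      rcases Nat.eq_zero_or_pos m with hm | hm
      · subst hm; simp at hx
      · exact ((Nat.div_lt_iff_lt_mul hm).2 (lt_of_lt_of_eq hx (Nat.mul_comm m k))).le
    · rw [if_neg hx]

/-- On the leading part the block is `⌊i/m⌋`. -/
theorem blkF_castAdd (i : Fin (m * k)) : blkF m k r (Fin.castAdd r i) = i.val / m := by
  unfold blkF; simp

/-- On the remainder the block label is `k`. -/
theorem blkF_natAdd (i : Fin r) : blkF m k r (Fin.natAdd (m * k) i) = k := by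
  unfold blkF; simp

/-- `blockIdx (mk) k i = ⌊ik/(mk)⌋ = ⌊i/m⌋`. -/
theorem blockIdx_mul (hk : 0 < k) (i : Fin (m * k)) : blockIdx (m * k) k i = i.val / m := by
  unfold blockIdx
  exact Nat.mul_div_mul_right _ _ hk

/-- Merging block `j < k` of the leading part and appending `z` = overriding block `j` of `blkF`. -/
theorem append_mergeBlock (hk : 0 < k) {j : ℕ} (hj : j < k) (v w : Fin (m * k) → Bool)
    (z : Fin r → Bool) :
    Fin.append (mergeBlock (m * k) k j v w) z =
      SumCodeZero.ovr (blkF m k r) j (Fin.append v z) (Fin.append w z) := by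
  funext x
  induction x using Fin.addCases with
  | left i =>
    simp only [SumCodeZero.ovr, Fin.append_left, blkF_castAdd, mergeBlock, blockIdx_mul hk]
  | right i =>
    simp only [SumCodeZero.ovr, Fin.append_right, blkF_natAdd]
    rw [if_neg (Nat.ne_of_gt hj)]

/-- The block-`j` weight of `u ++ z` for `blkF` (`j < k`) is the block-`j` weight of `u`. -/
theorem bw_append (hk : 0 < k) {j : ℕ} (hj : j < k) (u : Fin (m * k) → Bool) (z : Fin r → Bool) :
    SumCodeZero.bw (blkF m k r) j (Fin.append u z) = blockWt (m * k) k j u := by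
  unfold SumCodeZero.bw blockWt
  have hset : (univ.filter fun x : Fin (m * k + r) => blkF m k r x = j ∧ Fin.append u z x = true) =
      (univ.filter fun i : Fin (m * k) => blockIdx (m * k) k i = j ∧ u i = true).map
        (Fin.castAddEmb r) := by
    ext x
    simp only [mem_filter, mem_univ, true_and, mem_map]
    constructor
    · rintro ⟨hx, hux⟩
      induction x using Fin.addCases with
      | left i =>
        refine ⟨i, ⟨?_, ?_⟩, rfl⟩
        · rw [blockIdx_mul hk]; rwa [blkF_castAdd] at hx
        · rwa [Fin.append_left] at hux
      | right i =>
        rw [blkF_natAdd] at hx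
        exact absurd hx (Nat.ne_of_gt hj)
    · rintro ⟨i, ⟨hi, hui⟩, rfl⟩
      refine ⟨?_, ?_⟩
      · show blkF m k r (Fin.castAdd r i) = j
        rw [blkF_castAdd, ← blockIdx_mul hk]; exact hi
      · show Fin.append u z (Fin.castAdd r i) = true
        rw [Fin.append_left]; exact hui
  rw [hset, Finset.card_map]

/-- Restriction of a low-degree Boolean function along `Fin.append · z` keeps the degree. -/
theorem hasDeg_append {M D : ℕ} {f : (Fin (M + r) → Bool) → Bool} (hf : HasDeg f D)
    (z : Fin r → Bool) : HasDeg (fun u : Fin M → Bool => f (Fin.append u z)) D :=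
  comp_append_mem_lowDeg hf z

/-- Counting failures fibrewise over the remainder: `failCount win = Σ_z failCount (win(· ++ z))`. -/
theorem failCount_eq_sum_append {M : ℕ} (win : (Fin (M + r) → Bool) → Bool) :
    failCount win = ∑ z : Fin r → Bool, failCount (fun u : Fin M → Bool => win (Fin.append u z)) := by
  classical
  unfold failCount
  have h1 : (univ.filter fun x : Fin (M + r) → Bool => win x = false) =
      (univ.filter fun p : (Fin M → Bool) × (Fin r → Bool) =>
        win (Fin.append p.1 p.2) = false).map (Fin.appendEquiv M r).toEmbedding := by
    ext x
    simp only [mem_filter, mem_univ, true_and, mem_map, Equiv.coe_toEmbedding]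
    constructor
    · intro hx
      refine ⟨(Fin.appendEquiv M r).symm x, ?_, ?_⟩
      · have : Fin.append ((Fin.appendEquiv M r).symm x).1 ((Fin.appendEquiv M r).symm x).2 = x :=
          (Fin.appendEquiv M r).apply_symm_apply x
        rw [this]; exact hx
      · exact (Fin.appendEquiv M r).apply_symm_apply x
    · rintro ⟨p, hp, rfl⟩
      exact hp
  rw [h1, card_map, Finset.card_filter, Fintype.sum_prod_type_right]
  refine Finset.sum_congr rfl fun z _ => ?_
  rw [Finset.card_filter]

end TensorBlocksFixed

open TensorBlocksFixed

/-! ### Block splitting, fixed size -/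

/-- **`BlockSplitFixed t` for every `t` — PROVED** (restriction of the general monotone engine
`BlockSplitCore.sumCodeWinB_ringWinU` along `Fin.append · z`). -/
theorem blockSplitFixed (t : ℕ) : BlockSplitFixed t := by
  intro m k r D c y hk hD hdeg z
  obtain ⟨X, hX, hwin⟩ := BlockSplitCore.sumCodeWinB_ringWinU (blk := blkF m k r) blkF_mono hk hD c y hdeg
  refine ⟨fun j u => X j (Fin.append u z), fun j hj => ?_, fun u => hwin (Fin.append u z)⟩
  obtain ⟨T, hTdeg, hTeven, hTX⟩ := hX j hj
  refine ⟨fun s u => T s (Fin.append u z), fun s v => ?_, fun u => hTeven _, fun u => ?_⟩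
  · have heq : (fun w : Fin (m * k) → Bool => T s (Fin.append (mergeBlock (m * k) k j v w) z)) =
        fun w => (fun W => T s (SumCodeZero.ovr (blkF m k r) j (Fin.append v z) W)) (Fin.append w z) := by
      funext w
      rw [append_mergeBlock hk hj]
    show HasDeg (fun w : Fin (m * k) → Bool => T s (Fin.append (mergeBlock (m * k) k j v w) z)) t
    rw [heq]
    exact hasDeg_append (hTdeg s (Fin.append v z)) z
  · show X j (Fin.append u z) = T (blockWt (m * k) k j u % 3) (Fin.append u z)
    rw [hTX, bw_append hk hj]

/-! ### The degree-0 rung at a fixed block size -/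

/-- **`TensorMultAt m 0 β` for all large `m`**, `0 ≤ β < 1/3`: with `2/2^{m₀} ≤ 1 − 3β`, every `m ≥ m₀`
works (blocks `⌊ik/(mk)⌋` have exactly `m ≥ m₀` coordinates). -/
theorem tensorMultAt_zero {β : ℝ} (hβ0 : 0 ≤ β) (hβ : β < 1 / 3) :
    ∃ m₀ : ℕ, ∀ m ≥ m₀, TensorMultAt m 0 β := by
  classical
  obtain ⟨m₀, _, hm₀⟩ := TensorMultZero.exists_scale hβ
  refine ⟨m₀, fun m hm k hk win hwin => ?_⟩
  obtain ⟨X, hX, hw⟩ := hwin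
  have hex : ∀ j : ℕ, ∃ T : ℕ → (Fin (m * k) → Bool) → Bool, j < k →
      (∀ r, HasBlockDeg (m * k) k j 0 (T r)) ∧ (∀ u, xor (T 0 u) (xor (T 1 u) (T 2 u)) = false) ∧
        ∀ u, X j u = T (blockWt (m * k) k j u % 3) u := by
    intro j
    by_cases hj : j < k
    · obtain ⟨T, h1, h2, h3⟩ := hX j hj
      exact ⟨T, fun _ => ⟨h1, h2, h3⟩⟩
    · exact ⟨fun _ _ => false, fun h => absurd h hj⟩
  choose T hT using hex
  have hoff : ∀ j < k, ∀ (r : ℕ) (u a : Fin (m * k) → Bool),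
      T j r (SumCodeZero.ovr (blockIdx (m * k) k) j u a) = T j r u :=
    fun j hj r u a => TensorMultZero.apply_mergeBlock_of_hasBlockDeg_zero ((hT j hj).1 r) u a
  have heven : ∀ j < k, ∀ u : Fin (m * k) → Bool, xor (T j 0 u) (xor (T j 1 u) (T j 2 u)) = false :=
    fun j hj u => (hT j hj).2.1 u
  have hmk : m₀ ≤ m := hm
  have hbl : ∀ j < k, m₀ ≤ (univ.filter fun i : Fin (m * k) => blockIdx (m * k) k i = j).card :=
    fun j hj => le_trans hmk (SumCodeZero.le_card_blockIdx hk le_rfl hj)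
  have hβ' : β ≤ (1 - 2 / (2 : ℝ) ^ m₀) / 3 := by linarith
  have key := SumCodeZero.pow_mul_le_card_fails (bl := blockIdx (m * k) k) k T hoff heven hbl hβ0 hβ'
  have hfc : failCount win = (SumCodeZero.fails (blockIdx (m * k) k) k T).card := by
    unfold failCount SumCodeZero.fails
    congr 1
    ext u
    simp only [mem_filter, mem_univ, true_and]
    rw [hw u]
    unfold SumCodeZero.win
    have hf : ((range k).filter fun j => X j u = true) =
        (range k).filter fun j => T j (SumCodeZero.bw (blockIdx (m * k) k) j u % 3) u = true :=
      filter_congr fun j hj => by rw [(hT j (mem_range.1 hj)).2.2 u]; rfl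
    rw [hf]
  rw [hfc, mul_pow, ← pow_mul]
  exact key

/-! ### The reduction in the fixed-size form -/

/-- **`TensorMultAtPays` — PROVED** (ROUND-12 §2.2 / §2.7(c) arithmetic): with `k = ⌊D/(t+1)⌋ + 2`
term-carrying blocks of size `m` and the remainder free, `fail ≥ Σ_z (β·2^m)^k = β^k·2ⁿ ≥ 2^{n − cD}`
for `c = (1 + c₀)/2`, `c₀ = log₂(1/min(β,1))/(t+1) < 1`, `λ = 3m + 3`. -/
theorem tensorMultAtPays : TensorMultAtPays := by
  classical
  intro m t β hβ hBS hTM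
  have htR : (0 : ℝ) < (t : ℝ) + 1 := by positivity
  -- `β' = min β 1 = 2^L`, `-(t+1) < L ≤ 0`
  set β' : ℝ := min β 1 with hβ'
  have h2pow : (0 : ℝ) < (2 : ℝ) ^ (-((t : ℝ) + 1)) := Real.rpow_pos_of_pos two_pos _
  have hβ'gt : (2 : ℝ) ^ (-((t : ℝ) + 1)) < β' :=
    lt_min hβ (Real.rpow_lt_one_of_one_lt_of_neg one_lt_two (by linarith))
  have hβ'pos : 0 < β' := h2pow.trans hβ'gt
  have hβ'le1 : β' ≤ 1 := min_le_right _ _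
  have hβ'leβ : β' ≤ β := min_le_left _ _
  set L : ℝ := Real.logb 2 β' with hL
  have hLle : L ≤ 0 := Real.logb_nonpos one_lt_two hβ'pos.le hβ'le1
  have hLgt : -((t : ℝ) + 1) < L := by
    have := Real.logb_lt_logb one_lt_two h2pow hβ'gt
    rwa [Real.logb_rpow two_pos (by norm_num)] at this
  have hβ'L : β' = (2 : ℝ) ^ L := (Real.rpow_logb two_pos (by norm_num) hβ'pos).symm
  -- the exponent
  set c₀ : ℝ := -L / ((t : ℝ) + 1) with hc₀
  have hc₀lt : c₀ < 1 := by
    rw [hc₀, div_lt_one htR]; linarith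
  have hc₀nn : 0 ≤ c₀ := by rw [hc₀]; exact div_nonneg (by linarith) htR.le
  refine ⟨(c₀ + 1) / 2, by linarith, 3 * m + 3, ⌈-(4 * L) / (1 - c₀)⌉₊ + 1, ?_⟩
  intro D hD n hn ch y hdeg
  have hD1 : 1 ≤ D := by omega
  have hDR : (-(4 * L) / (1 - c₀) : ℝ) ≤ D := by
    have h1 : ((⌈-(4 * L) / (1 - c₀)⌉₊ : ℕ) : ℝ) ≤ D := by
      have : ⌈-(4 * L) / (1 - c₀)⌉₊ ≤ D := by omega
      exact_mod_cast this
    exact (Nat.le_ceil _).trans h1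
  have hDR' : -(4 * L) ≤ (1 - c₀) * D := by
    rw [div_le_iff₀ (by linarith)] at hDR; linarith
  -- the blocks: `k = ⌊D/(t+1)⌋ + 2` of size `m`, remainder `r = n - m k`
  obtain ⟨q, hq⟩ : ∃ q : ℕ, q = D / (t + 1) := ⟨_, rfl⟩
  have hqD : q ≤ D := by rw [hq]; exact Nat.div_le_self D (t + 1)
  have hDq : D < (t + 1) * (q + 1) := by rw [hq]; exact TensorBlocks.lt_blocks D t
  obtain ⟨k, hk⟩ : ∃ k : ℕ, k = q + 2 := ⟨_, rfl⟩
  have hk0 : 0 < k := by omega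
  have hkD : k ≤ D + 2 := by omega
  have hmk : m * k ≤ n := by
    have h1 : m * k ≤ m * (D + 2) := Nat.mul_le_mul_left m hkD
    have h2 : m * (D + 2) ≤ (3 * m + 3) * D := by nlinarith
    exact h1.trans (h2.trans hn)
  obtain ⟨r, rfl⟩ : ∃ r, n = m * k + r := ⟨n - m * k, by omega⟩
  have hDk : D < (t + 1) * (k - 1) := by
    have e : k - 1 = q + 1 := by omega
    rw [e]; exact hDq
  -- block splitting on every remainder fibre and multiplicativity
  have hfail : β ^ k * (2 : ℝ) ^ (m * k + r) ≤ (failCount (ringWinU ch y) : ℝ) := by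
    have hz : ∀ z : Fin r → Bool, (β * (2 : ℝ) ^ m) ^ k ≤
        (failCount (fun u : Fin (m * k) → Bool => ringWinU ch y (Fin.append u z)) : ℝ) :=
      fun z => hTM k hk0 _ (hBS m k r D ch y hk0 hDk hdeg z)
    have hsum := Finset.sum_le_sum fun z (_ : z ∈ (univ : Finset (Fin r → Bool))) => hz z
    rw [Finset.sum_const, card_univ, Fintype.card_fun, Fintype.card_bool, Fintype.card_fin,
      nsmul_eq_mul] at hsum
    rw [failCount_eq_sum_append (ringWinU ch y)]
    push_cast
    refine le_trans (le_of_eq ?_) hsum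
    rw [mul_pow, ← pow_mul, pow_add]
    push_cast
    ring
  have hsumR : (failCount (ringWinU ch y) : ℝ) +
      ((univ.filter fun u : Fin (m * k + r) → Bool => ringWinU ch y u = true).card : ℝ) =
        (2 : ℝ) ^ (m * k + r) := by
    exact_mod_cast TensorBlocks.failCount_add_card_win (ringWinU ch y)
  -- `2^{-(cD)} ≤ β'^k ≤ β^k`
  have hββ' : β' ^ k ≤ β ^ k := pow_le_pow_left₀ hβ'pos.le hβ'leβ k
  have hkR : ((k : ℕ) : ℝ) ≤ (D : ℝ) / ((t : ℝ) + 1) + 2 := by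
    have h1 : (q : ℝ) ≤ (D : ℝ) / ((t : ℝ) + 1) := by
      rw [le_div_iff₀ htR]
      have : q * (t + 1) ≤ D := by rw [hq]; exact Nat.div_mul_le_self D (t + 1)
      exact_mod_cast this
    rw [hk]; push_cast; linarith
  have hexp : -((c₀ + 1) / 2 * (D : ℝ)) ≤ L * k := by
    have h1 : L * ((D : ℝ) / ((t : ℝ) + 1) + 2) ≤ L * k := mul_le_mul_of_nonpos_left hkR hLle
    have h2 : L * ((D : ℝ) / ((t : ℝ) + 1) + 2) = -(c₀ * D) + 2 * L := by
      rw [hc₀]; field_simp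
    linarith
  have hpow : (2 : ℝ) ^ (-((c₀ + 1) / 2 * (D : ℝ))) ≤ β' ^ k := by
    rw [hβ'L, ← Real.rpow_natCast, ← Real.rpow_mul (by norm_num : (0 : ℝ) ≤ 2)]
    exact Real.rpow_le_rpow_of_exponent_le one_le_two hexp
  have h2n : (0 : ℝ) ≤ (2 : ℝ) ^ (m * k + r) := by positivity
  have hchain : (2 : ℝ) ^ (-((c₀ + 1) / 2 * (D : ℝ))) * (2 : ℝ) ^ (m * k + r) ≤
      (failCount (ringWinU ch y) : ℝ) :=
    le_trans (mul_le_mul_of_nonneg_right (hpow.trans hββ') h2n) hfail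
  linarith

/-- **`MultOneAtPays` — PROVED**: `BlockSplitFixed 1 → TensorMultOneAt → T10W`. -/
theorem multOneAtPays : MultOneAtPays := by
  intro hBS hM
  obtain ⟨m, β, hβ, hTM⟩ := hM
  refine tensorMultAtPays m 1 β ?_ hBS hTM
  have h : (2 : ℝ) ^ (-(((1 : ℕ) : ℝ) + 1)) = 1 / 4 := by
    rw [show (-(((1 : ℕ) : ℝ) + 1) : ℝ) = -((2 : ℕ) : ℝ) by norm_num,
      Real.rpow_neg (by norm_num), Real.rpow_natCast]
    norm_num
  rw [h]
  exact hβ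

/-- Hence `T10W` hangs on the crux of record alone: `TensorMultOneAt → T10W`. -/
theorem t10W_of_tensorMultOneAt (h : TensorMultOneAt) : T10W := multOneAtPays (blockSplitFixed 1) h

end Summit.QuantumAdvantage.AdviceFreeQNC0
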